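import Summits.BirchSwinnertonDyer.BirchSwinnertonDyer.Theorems.ManinLocalTwoThreeAdditiveDyadicTransport
import Literature.NumberTheory.EllipticCurves.ModularSymbolsParabolicCohomology
import Literature.NumberTheory.EllipticCurves.NewformsStrongMultiplicityOne
import HarnessLib

/-!
# Route `ManinLocalTwoThree` (cell `bsd-f2-manin`), cruxes C2 `ManinOddAtFour` (stmt-BirchSwinnertonDyer-22967) /
# C3 `ManinPrimeToThreeAtNine` (stmt-22968): the aligned dyadic twist transport is LEVEL-FREE

The landed additive dyadic transports (`ManinLocalTwoThreeAdditiveDyadicTransport`, seat p2 gen 2) read the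
twisted newform `f_A ⊗ χ` at the level `N` of the class `W` to be eliminated, and therefore need the partner's
level to divide it: `N(A) ∣ N` (plus `2⁴ ∣ N`, `2⁶ ∣ N` for `m² ∣ N`). So an optimal class could only be compared
with `χ±8`-partners of LOWER or EQUAL `2`-level. This file removes the restriction:
* §1 `maninLocalTwoThree_periodLattice_degeneracyMap0_one` — **the period lattice of `f ∈ S₂(Γ₀(N))` does not
  change under the degeneracy lift `ι₁` to any level `L` with `N ∣ L ∣ N^(k+1)`** (every prime of `L` divides
  `N`): the coset representatives of `Γ₀(L)` in `Γ₀(N)` can be taken parabolic at the cusp `0`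
  (`(1 0; jN 1)`, zero period; one squaring step `Γ₀(M) → Γ₀(M²)` is
  `maninLocalTwoThree_exists_mem_gamma0_pow_cuspSymbol_eq`, Manin Prop. 1.4 / Knapp Prop. 11.1; the tree's
  `X4/DegeneracyOneSurjective` is the one-prime case on `periodHomology`). No Ihara input inside the radical.
* §2 `maninLocalTwoThree_maninConstant_dvd_mul_of_twistStep_of_le` — the `Γ₀` lattice engine of T-an-7 §17
  with the hypothesis "`f_D` is the twist" weakened to `Λ(f_D) ⊆ Λ(f_{D'} ⊗ χ at level L)`.
* §3 `maninLocalTwoThree_maninConstant_dvd_mul_of_additiveTwist_of_char_level` — the additive dyadic engine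
  `c(D) ∣ r·c(D')` with the twist read at a COMMON level `L` (`N ∣ L ∣ N^(k+1)`, `N' ∣ L`, `m² ∣ L`).
* §4 `maninLocalTwoThree_maninConstant_dvd_of_additiveTwist_two_aligned_levelFree` — **`c(D) ∣ c(D')` along an
  ALIGNED `χ±8`-twist (`Δ(C) = d⁶Δ(A)`) for a partner `A` at ANY `2`-level `N(A) ∣ 2⁶N`** (`L = 2⁶N`).
Use: a `±2`-twist moves `v₂(Δ_min)` by `±6`, so read from its smaller-`|Δ|` end EVERY `±2` edge is aligned —
the cell's 13 677 "misaligned `2⁵ → 2⁶` lifts" (`c ∣ 2c'` only) are exact `2⁶ → 2⁵` transports to a partner of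
HIGHER level. Sequel: `ManinLocalTwoThreeManinOddAtFourDiscLevelMinimal.lean` (crux by name). Nothing here
proves BSD or Manin's conjecture. Seat bsd-line-manin23-p2 (gen 3). References: [Manin1972] Prop. 1.4,
Thm. 1.9; [Knapp1993] Prop. 11.1; [Stevens1989] Lemma (5.4); [Pal2012] Lemma 3.1; [SilvermanATAEC1994] IV.9.1.
-/

set_option autoImplicit false
set_option linter.dupNamespace false

noncomputable section

open scoped MatrixGroups ModularForm Classical NumberField

namespace Summit.BirchSwinnertonDyer.BirchSwinnertonDyer.Theorems

open CongruenceSubgroup WeierstrassCurve IsDedekindDomain IsDedekindDomain.HeightOneSpectrum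
  Rat.HeightOneSpectrum Literature.NumberTheory.Automorphic
  Literature.NumberTheory.EllipticCurves Literature.NumberTheory.EllipticCurves.ModularForms
  Summit.BirchSwinnertonDyer.Rank1Residual.ManinAdditive

/-! ## §1 The period lattice does not see a level lift inside the radical -/

/-- **Parabolic correction into a deeper level.** For `f ∈ S₂(Γ₀(N))`, every period `{∞, δ∞}_f`,
`δ ∈ Γ₀(N)`, is the period `{∞, γ∞}_f` of an element `γ ∈ Γ₀(N) ∩ Γ₀(N^(k+1))`: for `δ = (a b; c d)`,
`c = c₀N`, the element `δ · (1 0; −a c₀ N 1)` has lower-left entry `−b c₀² N²`, and `{∞, P∞}_f = 0` for the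
parabolic `P = (1 0; −a c₀ N 1)` (Manin's homomorphism `cuspSymbol_mul_holds`; Knapp Prop. 11.1); iterate.
Geometrically: `X₀(N^(k+1)) → X₀(N)` is totally ramified over the cusp `0`.
[cite: Manin1972, Prop. 1.4  Thm. 1.6] [cite: Knapp1993, Prop. 11.1] -/
theorem maninLocalTwoThree_exists_mem_gamma0_pow_cuspSymbol_eq {N : ℕ} [NeZero N]
    (f : CuspForm (Gamma0 N) 2) (k : ℕ) (δ : Gamma0 N) :
    ∃ γ : Gamma0 N, (γ : SL(2, ℤ)) ∈ Gamma0 (N ^ (k + 1)) ∧ cuspSymbol f γ = cuspSymbol f δ := by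
  induction k with
  | zero => exact ⟨δ, by rw [zero_add, pow_one]; exact δ.2, rfl⟩
  | succ k ih =>
    obtain ⟨γ, hγ, hper⟩ := ih
    -- entries of `γ`
    set a : ℤ := (γ : SL(2, ℤ)) 0 0 with ha
    set b : ℤ := (γ : SL(2, ℤ)) 0 1 with hb
    set c : ℤ := (γ : SL(2, ℤ)) 1 0 with hc
    set d : ℤ := (γ : SL(2, ℤ)) 1 1 with hd
    have hdet : a * d - b * c = 1 := by
      have := Matrix.det_fin_two (γ : SL(2, ℤ)).1
      rw [(γ : SL(2, ℤ)).2] at this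
      rw [ha, hb, hc, hd]; linarith
    set M : ℕ := N ^ (k + 1) with hM
    have hMc : (M : ℤ) ∣ c := by
      rw [Gamma0_mem] at hγ
      exact (ZMod.intCast_zmod_eq_zero_iff_dvd c M).mp hγ
    obtain ⟨c₀, hc₀⟩ := hMc
    have hNM : (N : ℤ) ∣ (M : ℤ) := by
      rw [hM]; push_cast; exact dvd_pow_self _ (Nat.succ_ne_zero k)
    -- the parabolic correction `P = (1 0; -(a c₀) M 1) ∈ Γ₀(N)`
    set j : ℤ := a * c₀ with hj
    let Pm : SL(2, ℤ) := ⟨!![1, 0; -(j * M), 1], by rw [Matrix.det_fin_two_of]; ring⟩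
    have hPmem : Pm ∈ Gamma0 N := by
      rw [Gamma0_mem]
      change (((-(j * (M : ℤ))) : ℤ) : ZMod N) = 0
      obtain ⟨m, hm⟩ := hNM
      rw [hm, (ZMod.intCast_zmod_eq_zero_iff_dvd _ N)]
      exact ⟨-(j * m), by ring⟩
    -- `γ P ∈ Γ₀(M²) ⊆ Γ₀(N^(k+2))`: its lower-left entry is `-b c₀² M²`
    have hγP : ((γ : SL(2, ℤ)) * Pm) ∈ Gamma0 (N ^ (k + 1 + 1)) := by
      rw [Gamma0_mem]
      have e : (((γ : SL(2, ℤ)) * Pm : SL(2, ℤ)) 1 0) = c + d * (-(j * M)) := by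
        simp [Pm, Matrix.mul_apply, Fin.sum_univ_two, hc, hd]
      rw [e]
      have hdiv : ((N ^ (k + 1 + 1) : ℕ) : ℤ) ∣ c + d * (-(j * M)) := by
        have e1 : c + d * (-(j * M)) = c₀ * M * (1 - a * d) := by rw [hj, hc₀]; ring
        have e2 : (1 : ℤ) - a * d = -(b * c) := by linarith
        rw [e1, e2, hc₀]
        have hMM : ((N ^ (k + 1 + 1) : ℕ) : ℤ) ∣ (M : ℤ) * M := by
          rw [hM]; push_cast
          rw [← pow_add]
          exact pow_dvd_pow _ (by omega)
        obtain ⟨t, ht⟩ := hMM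
        refine ⟨-(b * c₀ ^ 2 * t), ?_⟩
        calc c₀ * (M : ℤ) * -(b * ((M : ℤ) * c₀)) = -(b * c₀ ^ 2) * ((M : ℤ) * M) := by ring
          _ = -(b * c₀ ^ 2) * (((N ^ (k + 1 + 1) : ℕ) : ℤ) * t) := by rw [ht]
          _ = ((N ^ (k + 1 + 1) : ℕ) : ℤ) * -(b * c₀ ^ 2 * t) := by ring
      exact (ZMod.intCast_zmod_eq_zero_iff_dvd _ _).mpr hdiv
    -- `{∞, P∞}_f = 0` (parabolic), so the period is unchanged
    have hP0 : cuspSymbol f ⟨Pm, hPmem⟩ = 0 := by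
      refine cuspSymbol_eq_zero_of_discr_eq_zero f ?_
      change (Pm : Matrix (Fin 2) (Fin 2) ℤ).discr = 0
      rw [Matrix.discr_fin_two, Matrix.trace_fin_two, Matrix.SpecialLinearGroup.det_coe]
      simp [Pm]
    refine ⟨γ * ⟨Pm, hPmem⟩, hγP, ?_⟩
    rw [cuspSymbol_mul_holds f γ ⟨Pm, hPmem⟩, hP0, add_zero, hper]

/-- The cusp-to-cusp periods of the level lift `ι₁ f ∈ S₂(Γ₀(L))` (`N ∣ L`; the same function on `ℍ`) are the
periods of `f` over the elements of `Γ₀(L) ≤ Γ₀(N)`. [cite: CremonaAlgorithms1997, §2.4 (2.4.1)–(2.4.2)] -/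
theorem maninLocalTwoThree_cuspSymbol_degeneracyMap0_one {N L : ℕ} [NeZero N] [NeZero L]
    (f : CuspForm (Gamma0 N) 2) (hNL : N ∣ L) (γ : Gamma0 L) (hγ : (γ : SL(2, ℤ)) ∈ Gamma0 N) :
    cuspSymbol (degeneracyMap0 N L 1 2 f) γ = cuspSymbol f ⟨γ, hγ⟩ := by
  simp only [cuspSymbol]
  by_cases hc : ((γ : SL(2, ℤ)) 1 0) = 0
  · rw [if_pos hc, if_pos hc]
  · rw [if_neg hc, if_neg hc]
    simp only [modularSymbol, coe_degeneracyMap0_one N L 2 hNL]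

/-- `Γ₀(L) ≤ Γ₀(N)` for `N ∣ L`, on elements. [folklore] -/
theorem maninLocalTwoThree_mem_gamma0_of_dvd {N L : ℕ} (hNL : N ∣ L) {γ : SL(2, ℤ)} (hγ : γ ∈ Gamma0 L) :
    γ ∈ Gamma0 N := by
  rw [Gamma0_mem] at hγ ⊢
  exact (ZMod.intCast_zmod_eq_zero_iff_dvd _ N).mpr
    ((Int.natCast_dvd_natCast.mpr hNL).trans ((ZMod.intCast_zmod_eq_zero_iff_dvd _ L).mp hγ))

/-- **The period lattice is invariant under level lifts inside the radical.** For `f ∈ S₂(Γ₀(N))` and a level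
`L` with `N ∣ L ∣ N^(k+1)` (every prime of `L` divides `N`), the period lattice of the oldform `ι₁ f ∈ S₂(Γ₀(L))`
(periods over `Γ₀(L)`) EQUALS `Λ_f` (periods over `Γ₀(N)`): `⊆` since `Γ₀(L) ≤ Γ₀(N)`; `⊇` by the parabolic
correction `maninLocalTwoThree_exists_mem_gamma0_pow_cuspSymbol_eq` (`X₀(N^(k+1)) → X₀(N)` is totally
ramified at the cusp `0`, so `π₁` and `H₁` surject). For a prime `ℓ ∤ N` the lift to level `Nℓ` would only give
a sublattice (index related to Ihara's lemma); the point is that no Ihara input is needed inside the radical.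
[cite: Manin1972, Prop. 1.4  Thm. 1.9] [cite: Knapp1993, Prop. 11.1] -/
theorem maninLocalTwoThree_periodLattice_degeneracyMap0_one {N L : ℕ} [NeZero N] [NeZero L]
    (f : CuspForm (Gamma0 N) 2) (hNL : N ∣ L) (k : ℕ) (hLN : L ∣ N ^ (k + 1)) :
    periodLattice (degeneracyMap0 N L 1 2 f) = periodLattice f := by
  apply le_antisymm
  · rw [periodLattice, AddSubgroup.closure_le]
    rintro _ ⟨γ, rfl⟩
    rw [SetLike.mem_coe,
      maninLocalTwoThree_cuspSymbol_degeneracyMap0_one f hNL γ (maninLocalTwoThree_mem_gamma0_of_dvd hNL γ.2)]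
    exact cuspSymbol_mem_periodLattice f _
  · rw [periodLattice, AddSubgroup.closure_le]
    rintro _ ⟨δ, rfl⟩
    obtain ⟨γ, hγ, hper⟩ := maninLocalTwoThree_exists_mem_gamma0_pow_cuspSymbol_eq f k δ
    have hγL : (γ : SL(2, ℤ)) ∈ Gamma0 L := maninLocalTwoThree_mem_gamma0_of_dvd hLN hγ
    rw [SetLike.mem_coe, ← hper,
      ← maninLocalTwoThree_cuspSymbol_degeneracyMap0_one f hNL ⟨(γ : SL(2, ℤ)), hγL⟩ γ.2]
    exact cuspSymbol_mem_periodLattice _ _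

/-- The `q`-expansion of the level lift `ι₁ f` is that of `f`. [folklore] -/
theorem maninLocalTwoThree_cuspCoeff_degeneracyMap0_one {N L : ℕ} [NeZero N] [NeZero L]
    (f : CuspForm (Gamma0 N) 2) (hNL : N ∣ L) (n : ℕ) :
    cuspCoeff (degeneracyMap0 N L 1 2 f) n = cuspCoeff f n := by
  unfold cuspCoeff
  rw [coe_degeneracyMap0_one N L 2 hNL]

/-! ## §2 The `Γ₀` lattice engine at a COMMON level -/

/-- **The `Γ₀` lattice engine with the twist read at a common level `L`.** Verbatim the tree's
`maninConstant_dvd_mul_of_twistStep` (T-an-7 §17), except that the hypothesis "`f_D` IS the twisted form at level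
`N`" is replaced by the lattice inclusion `Λ(f_D) ⊆ Λ(f_{D'} ⊗ χ read at level L)` — which is all the proof
uses; with `maninLocalTwoThree_periodLattice_degeneracyMap0_one` this inclusion holds for ANY common level
`L` with `N ∣ L ∣ N^(k+1)`, so the partner's level `N'` need no longer divide `N`. Chain: `Λ_W = c·Λ(f_D)`,
`s·Λ(f_{D'} ⊗ χ) ⊆ Λ(f_{D'})`, `c'·Λ(f_{D'}) ⊆ Λ_A`, `r·z ∈ Λ_C` whenever `s·z ∈ Λ_A`; hence
`(r c'/c)·Λ_W ⊆ Λ_C` and the Néron scaling `r c'/c` is an integer (`integral_neronScaling_of_isGloballyMinimal`).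
[cite: Stevens1989, Lemma (5.4) p. 97] [cite: SilvermanATAEC1994, Cor. IV.9.1] -/
theorem maninLocalTwoThree_maninConstant_dvd_mul_of_twistStep_of_le
    {A : WeierstrassCurve ℚ} {N' : ℕ} [NeZero N']
    {W : WeierstrassCurve ℚ} [W.IsElliptic] [W.IsGloballyMinimal] {N : ℕ} [NeZero N] {L : ℕ} [NeZero L]
    {m : ℕ} [NeZero m] {χ : DirichletCharacter ℂ m}
    {C : WeierstrassCurve ℚ} [C.IsElliptic] [C.IsGloballyMinimal] {LC : PeriodPair}
    (D' : ModularParametrizationData A N') (D : ModularParametrizationData W N)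
    (h : ∀ z ∈ D.L.lattice, ∃ w ∈ periodLattice D.f, z = D.c * w)
    (hχ : χ.IsQuadratic) (hN : N' ∣ L) (hm : m ^ 2 ∣ L)
    (hle : periodLattice D.f ≤ periodLattice (charTwist L hN hm hχ D'.f)) (s : ℂ)
    (hstep : ∀ w ∈ periodLattice (charTwist L hN hm hχ D'.f), s * w ∈ periodLattice D'.f)
    (hC : IsNeronLatticeOf (C.baseChange ℂ) LC) (r : ℤ)
    (hLC : ∀ z : ℂ, s * z ∈ D'.L.lattice → (r : ℂ) * z ∈ LC.lattice) :
    D.c ∣ r * D'.c := by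
  have hc : D.c ≠ 0 := D.maninConstant_ne_zero_holds
  have key : ∀ z ∈ D.L.lattice, ((((r * D'.c : ℚ) / D.c : ℚ)) : ℂ) * z ∈ LC.lattice := by
    intro z hz
    obtain ⟨w, hw, rfl⟩ := h z hz
    have hw' : s * w ∈ periodLattice D'.f := hstep w (hle hw)
    have h3 : (D'.c : ℂ) * (s * w) ∈ D'.L.lattice := D'.smul_periodLattice_le _ hw'
    have h4 : (r : ℂ) * ((D'.c : ℂ) * w) ∈ LC.lattice :=
      hLC _ (by rw [show s * ((D'.c : ℂ) * w) = (D'.c : ℂ) * (s * w) by ring]; exact h3)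
    have hcℂ : (D.c : ℂ) ≠ 0 := by exact_mod_cast hc
    convert h4 using 1
    push_cast
    field_simp
  obtain ⟨k, hk⟩ :=
    integral_neronScaling_of_isGloballyMinimal_holds W C D.L LC D.isNeronLattice hC _ key
  have hcℚ : (D.c : ℚ) ≠ 0 := by exact_mod_cast hc
  have h' : ((r : ℚ) * D'.c : ℚ) = D.c * k := by
    rw [hk]
    field_simp
  exact ⟨k, by exact_mod_cast h'⟩

/-! ## §3 The additive dyadic engine at a common level -/

/-- **Additive → additive dyadic twist engine at a COMMON level (generic character).** As the landed
`maninLocalTwoThree_maninConstant_dvd_mul_of_additiveTwist_of_char`, but the twist `f_{D'} ⊗ χ` is read at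
ANY level `L` with `N ∣ L ∣ N^(k+1)`, `N' ∣ L`, `m² ∣ L` — so the partner `A` (level `N'`) may sit at a HIGHER
`2`-level than `W` (level `N`). `W` globally minimal with a lattice-optimal `X₀(N)`-datum `D`, additive at
`2`; `A` globally minimal, additive at `2`, ANY `X₀(N')`-datum `D'`, `4 ∣ N'`; `χ` primitive quadratic mod `m`
killing the even residues, `g(χ)² = 4d`, `aₙ(A ⊗ d) = χ(n) aₙ(A)` at odd `n`, Birch sum collapsing under
HALF-TRANSLATE; `W ∼ A ⊗ ℚ(√d)`; `C = u • (A ⊗ d)` globally minimal with `r¹² Δ(C) = d⁶ Δ(A)`. Then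
`c(D) ∣ r · c(D')`. New ingredient: `Λ(f_D) = Λ(ι₁ f_D)` at level `L`
(`maninLocalTwoThree_periodLattice_degeneracyMap0_one`) and `ι₁ f_D = f_{D'} ⊗ χ` there by `q`-expansions.
[cite: Stevens1989, Lemma (5.4) p. 97] [cite: Pal2012, Lemma 3.1] [cite: SilvermanATAEC1994, Cor. IV.9.1] -/
theorem maninLocalTwoThree_maninConstant_dvd_mul_of_additiveTwist_of_char_level
    {W : WeierstrassCurve ℚ} [W.IsElliptic] [W.IsGloballyMinimal] {N : ℕ} [NeZero N]
    (D : ModularParametrizationData W N)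
    (hopt : ∀ z ∈ D.L.lattice, ∃ w ∈ periodLattice D.f, z = D.c * w)
    {A : WeierstrassCurve ℚ} [A.IsElliptic] [A.IsGloballyMinimal] {N' : ℕ} [NeZero N']
    (D' : ModularParametrizationData A N')
    {d : ℤ} (hd : d ≠ 0)
    {m : ℕ} [NeZero m] {χ : DirichletCharacter ℂ m} (hχq : χ.IsQuadratic) (hχp : χ.IsPrimitive)
    (hG : gaussSum χ (ZMod.stdAddChar (N := m)) ^ 2 = ((4 * d : ℤ) : ℂ))
    (hsumOf : (∀ x : ℚ, modularSymbol D'.f (x + 1 / 2) = -modularSymbol D'.f x) →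
      ∀ x : ℚ, ∃ (u₁ u₂ : ZMod m) (ε : ℤ),
        ∑ v : ZMod m, χ v * modularSymbol D'.f (x + twistShift v) =
          2 * (modularSymbol D'.f (x + twistShift u₁) + ε * modularSymbol D'.f (x + twistShift u₂)))
    (hχodd : ∀ n : ℕ, ¬ 2 ∣ n →
      (((A.quadraticTwist (d : ℚ)).LFunction n : ℤ) : ℂ) = χ n * ((A.LFunction n : ℤ) : ℂ))
    (hχeven : ∀ n : ℕ, 2 ∣ n → χ n = 0)
    (htw : IsIsogenous W (A.quadraticTwist (d : ℚ)))
    {C : WeierstrassCurve ℚ} [C.IsElliptic] [C.IsGloballyMinimal] (u : VariableChange ℚ)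
    (hu : u • A.quadraticTwist (d : ℚ) = C) {r : ℤ} (hΔ : (r : ℚ) ^ 12 * C.Δ = (d : ℚ) ^ 6 * A.Δ)
    {L : ℕ} [NeZero L] (hNL : N ∣ L) (k : ℕ) (hLN : L ∣ N ^ (k + 1)) (hN'L : N' ∣ L) (hmL : m ^ 2 ∣ L)
    (h4N' : 4 ∣ N')
    (haddA : ¬ A.HasGoodReductionAtPrime 2 ∧ ¬ A.HasMultiplicativeReductionAtPrime 2)
    (hadd : ¬ W.HasGoodReductionAtPrime 2 ∧ ¬ W.HasMultiplicativeReductionAtPrime 2) :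
    D.c ∣ r * D'.c := by
  have hd0 : (d : ℚ) ≠ 0 := by exact_mod_cast hd
  haveI : (A.quadraticTwist (d : ℚ)).IsElliptic := A.isElliptic_quadraticTwist hd0
  set s : ℂ := gaussSum χ (ZMod.stdAddChar (N := m)) / 2 with hs
  have hG0 : gaussSum χ (ZMod.stdAddChar (N := m)) ≠ 0 :=
    gaussSum_stdAddChar_ne_zero_of_isPrimitive hχp
  have hs0 : s ≠ 0 := div_ne_zero hG0 two_ne_zero
  have hs2 : s ^ 2 = ((d : ℚ) : ℂ) := by
    rw [hs, div_pow, hG]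
    push_cast
    ring
  -- HALF-TRANSLATE for `f_{D'}`: the even coefficients of the newform of `A` vanish (`A` additive at `2`)
  have heven : ∀ n : ℕ, 2 ∣ n → cuspCoeff D'.f n = 0 := by
    intro n hn
    rw [D'.isNewformOf.2 n, A.LFunction_apply_eq_zero_of_not_good_of_not_mult 2 haddA.1 haddA.2 hn]
    simp
  have hhalf : ∀ x : ℚ, modularSymbol D'.f (x + 1 / 2) = -modularSymbol D'.f x :=
    maninLocalTwoThree_modularSymbol_add_half_eq_neg_of_four_dvd D'.f h4N' heven
  -- the exact twist step `s · Λ(f_{D'} ⊗ χ) ⊆ Λ(f_{D'})`, the twist read at level `L`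
  have hstep : ∀ w ∈ periodLattice (charTwist L hN'L hmL hχq D'.f), s * w ∈ periodLattice D'.f :=
    fun w hw ↦ half_gaussSum_mul_mem_periodLattice_of_mem_charTwist L hN'L hmL hχq hχp D'.f
      (hsumOf hhalf) hw
  -- the newform of `W` is the `χ`-twist of that of `A` (as `q`-expansions)
  have hLtw : W.LFunction = (A.quadraticTwist (d : ℚ)).LFunction :=
    LFunction_eq_of_isIsogenous_holds _ _ htw
  have hf : ∀ n : ℕ, cuspCoeff D.f n = χ n * cuspCoeff D'.f n := by
    intro n
    rw [D.isNewformOf.2 n, D'.isNewformOf.2 n]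
    by_cases h2n : 2 ∣ n
    · have h0 : W.LFunction n = 0 :=
        W.LFunction_apply_eq_zero_of_not_good_of_not_mult 2 hadd.1 hadd.2 h2n
      rw [h0, hχeven n h2n]
      simp
    · have hLn' : W.LFunction n = (A.quadraticTwist (d : ℚ)).LFunction n := by rw [hLtw]
      rw [hLn', hχodd n h2n]
  -- at level `L`: the lift `ι₁ f_D` IS `f_{D'} ⊗ χ`, and `Λ(ι₁ f_D) = Λ(f_D)` (no Ihara input inside the radical)
  have hlift : degeneracyMap0 N L 1 2 D.f = charTwist L hN'L hmL hχq D'.f :=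
    eq_of_forall_cuspCoeff_eq_gamma0 fun n ↦ by
      rw [maninLocalTwoThree_cuspCoeff_degeneracyMap0_one D.f hNL, hf, cuspCoeff_charTwist L hN'L hmL hχq hχp]
  have hle : periodLattice D.f ≤ periodLattice (charTwist L hN'L hmL hχq D'.f) := by
    rw [← hlift, maninLocalTwoThree_periodLattice_degeneracyMap0_one D.f hNL k hLN]
  -- Néron lattice of the minimal model `C` of `A ⊗ d`: `z ∈ Λ_C ↔ s r⁻¹ z ∈ Λ_A`
  obtain ⟨LC, hC⟩ := exists_isNeronLatticeOf_holds (C.baseChange ℂ)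
  have hLC : ∀ z : ℂ, s * z ∈ D'.L.lattice → (r : ℂ) * z ∈ LC.lattice := by
    intro z hz
    rw [neronLattice_mem_iff_of_twist_of_sq_eq hd0 u hu hΔ hs2 D'.isNeronLattice hC]
    by_cases hr : (r : ℚ) = 0
    · have : ((r : ℚ) : ℂ) = 0 := by exact_mod_cast hr
      rw [show (r : ℂ) = ((r : ℚ) : ℂ) by push_cast; rfl, this, zero_mul, mul_zero, mul_zero]
      exact zero_mem _
    · have hrC : ((r : ℚ) : ℂ) ≠ 0 := by exact_mod_cast hr
      have e : s * ((((r : ℚ) : ℂ))⁻¹ * ((r : ℂ) * z)) = s * z := by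
        rw [show (r : ℂ) = ((r : ℚ) : ℂ) by push_cast; rfl]
        field_simp
      rw [e]
      exact hz
  exact maninLocalTwoThree_maninConstant_dvd_mul_of_twistStep_of_le D' D hopt hχq hN'L hmL hle s hstep hC r
    hLC

/-! ## §4 Aligned `χ±8` transport, LEVEL-FREE -/

/-- `2⁶ · N ∣ N⁴` for `4 ∣ N` (the common level `L = 2⁶N` lies inside the radical of `N`). [elementary] -/
theorem maninLocalTwoThree_two_pow_six_mul_dvd_pow_four {N : ℕ} (h4 : 2 ^ 2 ∣ N) :
    2 ^ 6 * N ∣ N ^ (3 + 1) := by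
  obtain ⟨t, rfl⟩ := h4; exact ⟨t ^ 3, by ring⟩

/-- **Exact divisibility `c(D) ∣ c(D')` along an ADDITIVE `χ±8`-twist with aligned discriminants, LEVEL-FREE**
(granted modularity `hnf`). `W` globally minimal with a lattice-optimal `X₀(N)`-datum `D`, `4 ∣ N`; `A` globally
minimal, additive at `2`, with ANY `X₀(N')`-datum `D'` and `N(A) ∣ 2⁶·N` — i.e. `A` may sit at a LOWER, the
SAME or a HIGHER `2`-level than `W` (the landed `…_of_additiveTwist_two_aligned` needed `N(A) ∣ N`, `2⁶ ∣ N`);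
`W ∼ A ⊗ ℚ(√d)`, `d = ±2`; the minimal model `C = u • (A ⊗ d)` has `Δ(C) = d⁶ Δ(A)` (ALIGNED). Then
`c(D) ∣ c(D')`: §3 at the common level `L = 2⁶N` (`N ∣ L ∣ N⁴`, `8² ∣ L`), `χ = χ₈ / χ₈′`, `r = 1`. Use: the
lower-level ends of the cell's 13 677 MISALIGNED `2⁵ → 2⁶` lifts (where `c ∣ 2c'` was all the tree had) are
ALIGNED lifts of their `2⁶`-partners read downwards, hence exactly transported.
[cite: Stevens1989, Lemma (5.4) p. 97] [cite: Pal2012, Prop. 2.4 (clause d ≡ 2 mod 4), Lemma 3.1] -/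
theorem maninLocalTwoThree_maninConstant_dvd_of_additiveTwist_two_aligned_levelFree
    (hnf : exists_isNewformOf)
    {W : WeierstrassCurve ℚ} [W.IsElliptic] [W.IsGloballyMinimal] {N : ℕ} [NeZero N]
    (D : ModularParametrizationData W N)
    (hopt : ∀ z ∈ D.L.lattice, ∃ w ∈ periodLattice D.f, z = D.c * w) (h4 : 2 ^ 2 ∣ N)
    {d : ℤ} (hd : d = 2 ∨ d = -2)
    {A : WeierstrassCurve ℚ} [A.IsElliptic] [A.IsGloballyMinimal] {N' : ℕ} [NeZero N']
    (D' : ModularParametrizationData A N')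
    (htw : IsIsogenous W (A.quadraticTwist (d : ℚ)))
    (h4A : 2 ^ 2 ∣ A.conductorNorm ℤ) (hAN : A.conductorNorm ℤ ∣ 2 ^ 6 * N)
    {C : WeierstrassCurve ℚ} [C.IsElliptic] [C.IsGloballyMinimal] (u : VariableChange ℚ)
    (hu : u • A.quadraticTwist (d : ℚ) = C) (hΔ : C.Δ = (d : ℚ) ^ 6 * A.Δ) :
    D.c ∣ D'.c := by
  haveI : Fact (Nat.Prime 2) := ⟨Nat.prime_two⟩
  haveI : NeZero (2 ^ 6 * N) := ⟨mul_ne_zero (by norm_num) (NeZero.ne N)⟩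
  have hdZ : d ≠ 0 := by rcases hd with rfl | rfl <;> norm_num
  -- `W`, `A` additive at `2`; the level of `D'` is `N(A)`
  have hN : N = W.conductorNorm ℤ :=
    IsNewformOf.level_eq_conductorNorm_of_exists_isNewformOf hnf D.isNewformOf
  have hadd : ¬ W.HasGoodReductionAtPrime 2 ∧ ¬ W.HasMultiplicativeReductionAtPrime 2 :=
    not_good_and_not_mult_of_sq_dvd_conductorNorm W (hN ▸ h4)
  have hN' : N' = A.conductorNorm ℤ :=
    IsNewformOf.level_eq_conductorNorm_of_exists_isNewformOf hnf D'.isNewformOf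
  have haddA : ¬ A.HasGoodReductionAtPrime 2 ∧ ¬ A.HasMultiplicativeReductionAtPrime 2 :=
    not_good_and_not_mult_of_sq_dvd_conductorNorm A h4A
  have hΔ' : ((1 : ℤ) : ℚ) ^ 12 * C.Δ = (d : ℚ) ^ 6 * A.Δ := by rw [hΔ]; norm_num
  have h4N' : 4 ∣ N' := by rw [hN']; simpa using h4A
  -- the common level `L = 2⁶ N`
  have hNL : N ∣ 2 ^ 6 * N := dvd_mul_left N _
  have hLN : 2 ^ 6 * N ∣ N ^ (3 + 1) := maninLocalTwoThree_two_pow_six_mul_dvd_pow_four h4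
  have hN'L : N' ∣ 2 ^ 6 * N := hN' ▸ hAN
  have hmL : 8 ^ 2 ∣ 2 ^ 6 * N := ⟨N, by norm_num⟩
  have hdvd : D.c ∣ 1 * D'.c := by
    rcases hd with rfl | rfl
    · exact maninLocalTwoThree_maninConstant_dvd_mul_of_additiveTwist_of_char_level D hopt D' hdZ
        isQuadratic_χ₈_ringHomComp isPrimitive_χ₈_ringHomComp
        (by rw [gaussSum_χ₈_ringHomComp_sq]; norm_num)
        (fun hhalf x ↦ ⟨1, 3, -1, sum_χ₈_modularSymbol_of_half D'.f hhalf x⟩)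
        (fun n hn ↦ by
          rw [show ((2 : ℤ) : ℚ) = 2 by norm_num, A.LFunction_quadraticTwist_two_apply_of_odd hn,
            Int.cast_mul, χ₈_ringHomComp_apply_natCast])
        (fun n hn ↦ by
          rw [χ₈_ringHomComp_apply_natCast, ZMod.χ₈_nat_eq_if_mod_eight,
            if_pos (Nat.mod_eq_zero_of_dvd hn)]
          simp)
        htw u hu hΔ' hNL 3 hLN hN'L hmL h4N' haddA hadd
    · exact maninLocalTwoThree_maninConstant_dvd_mul_of_additiveTwist_of_char_level D hopt D' hdZ
        isQuadratic_χ₈'_ringHomComp isPrimitive_χ₈'_ringHomComp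
        (by rw [gaussSum_χ₈'_ringHomComp_sq]; norm_num)
        (fun hhalf x ↦ ⟨1, 3, 1, sum_χ₈'_modularSymbol_of_half D'.f hhalf x⟩)
        (fun n hn ↦ by
          rw [show ((-2 : ℤ) : ℚ) = -2 by norm_num, A.LFunction_quadraticTwist_neg_two_apply_of_odd hn,
            Int.cast_mul, χ₈'_ringHomComp_apply_natCast])
        (fun n hn ↦ by
          rw [χ₈'_ringHomComp_apply_natCast, ZMod.χ₈'_nat_eq_if_mod_eight,
            if_pos (Nat.mod_eq_zero_of_dvd hn)]
          simp)
        htw u hu hΔ' hNL 3 hLN hN'L hmL h4N' haddA hadd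
  rwa [one_mul] at hdvd

/-- **Transport of `p ∤ c` along an aligned additive `±2`-twist, LEVEL-FREE** (any prime `p`; granted
modularity): in the situation of `maninLocalTwoThree_maninConstant_dvd_of_additiveTwist_two_aligned_levelFree`,
`p ∤ c(D')` implies `p ∤ c(D)`. [cite: Stevens1989, Lemma (5.4) p. 97] [cite: Pal2012, Lemma 3.1] -/
theorem maninLocalTwoThree_not_dvd_maninConstant_of_additiveUntwist_two_aligned_levelFree
    (hnf : exists_isNewformOf)
    {W : WeierstrassCurve ℚ} [W.IsElliptic] [W.IsGloballyMinimal] {N : ℕ} [NeZero N]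
    (D : ModularParametrizationData W N)
    (hopt : ∀ z ∈ D.L.lattice, ∃ w ∈ periodLattice D.f, z = D.c * w) (h4 : 2 ^ 2 ∣ N)
    {d : ℤ} (hd : d = 2 ∨ d = -2)
    {A : WeierstrassCurve ℚ} [A.IsElliptic] [A.IsGloballyMinimal] {N' : ℕ} [NeZero N']
    (D' : ModularParametrizationData A N')
    (htw : IsIsogenous W (A.quadraticTwist (d : ℚ)))
    (h4A : 2 ^ 2 ∣ A.conductorNorm ℤ) (hAN : A.conductorNorm ℤ ∣ 2 ^ 6 * N)
    {C : WeierstrassCurve ℚ} [C.IsElliptic] [C.IsGloballyMinimal] (u : VariableChange ℚ)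
    (hu : u • A.quadraticTwist (d : ℚ) = C) (hΔ : C.Δ = (d : ℚ) ^ 6 * A.Δ) {p : ℤ}
    (hp : ¬ p ∣ D'.maninConstant) : ¬ p ∣ D.maninConstant :=
  fun h ↦ hp (h.trans (maninLocalTwoThree_maninConstant_dvd_of_additiveTwist_two_aligned_levelFree hnf D hopt
    h4 hd D' htw h4A hAN u hu hΔ))

end Summit.BirchSwinnertonDyer.BirchSwinnertonDyer.Theorems

end
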